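import Summits.BirchSwinnertonDyer.BirchSwinnertonDyer.Theorems.PrintX9MuPartSpecWitnessDefs
import Literature.NumberTheory.EllipticCurves.IwasawaAlgebraEisensteinQuotientTorsionProofs
import HarnessLib

/-!
# ASSEMBLING a `SpecWitness` at `q_m` from its two arithmetic inputs in their natural form: S1 = control maps
# with cardinality-bounded coker/ker, S2 = the DVR structure statement over `S_m = Λ/(T^m + p)` (proofs file)

Cell `pub/bsd-print-x9`, seat `bsd-line-x9-p1-w2` (g4). THEOREMS ONLY; no definition, no named fact, no `sorry`;
ROUTE-INDEPENDENT. Namespace of the shared letters / witness interface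
(`Summit.BirchSwinnertonDyer.BirchSwinnertonDyer.Theorems.HeegnerMuPartStabilized`, files
`PrintX9MuPartSpecWitnessDefs` p632362, `PrintX9MuPartStabilizedOfSpecWitnesses` p633080).

WHAT. `nonempty_specWitness_of_dvrData`: let `S ⊇ L`, `X` be `Λ`-modules (`𝔖 ⊇ Λκ_∞(C)`, `𝒳`), `m ≥ 1`,
`q_m = T^m + p`, and let `H`, `Xq` be modules over the DVR `S_m = Λ/(q_m)` (with their `Λ`-structure through
`Λ → S_m`). GIVEN
* (S1) `Λ`-linear control maps `f : S → H` with `#(H ⧸ range f) ≤ c` and `h : X/q_mX → Xq` with `#ker h ≤ c`,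
  an element `κ₁ ∈ H` with `f(L) ⊆ Λ∙κ₁`;
* (S2, the DVR Kolyvagin bound in its printed shape) `H` free of rank one over `S_m` (`e : H ≃ S_m`), `κ₁ ≠ 0`,
  `Xq` finitely generated over `S_m` with `ℓ_{S_m}(Xq_tors) ≤ 2 · ℓ_{S_m}(H ⧸ S_m∙κ₁)` [the shape delivered by
  Howard Thm. 1.6.1: `H¹_ℱ(K,T)` free of rank one, `H¹_ℱ(K,A) ≅ D ⊕ M ⊕ M`, `ℓ(M) ≤ ℓ(H¹_ℱ(K,T)/Rκ₁)`, dualised;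
  Mastella–Zerman Thm. 2.40] (an `M ⊕ M` form is the corollary `nonempty_specWitness_of_dvrData_prod`),
THEN `Nonempty (SpecWitness Λ S X L q_m c)`. All currency conversions (module torsion vs `ℤ`-torsion,
`S_m`-span vs `Λ`-span of `κ₁`, lengths vs cardinalities `#N = p^{ℓ(N)}`) are discharged by this seat's
`IwasawaAlgebraEisensteinQuotient{DVR,Torsion}Proofs`. So the arithmetic port files EXACTLY: the carrier
(x10b-p1 LEAD g5's `eisensteinTwist`, in flight), the two control maps with their cardinality bounds (S1),
and the DVR structure statement (S2) — and calls this lemma for every `m ≥ m₀`.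
HONEST FRAMING: nothing here constructs `f`, `h`, `e`, `M`; «beyond-print theorem»: no. BSD is not proved
by any of this; no summit statement is proved by this seat.

References: [Howard2004HeegnerKolyvagin] Thm. 1.6.1, Prop. 2.2.8, proof of Thm. 2.2.10 (𝔮 = T^m + p);
[MastellaZerman2026] Thm. 2.40.
-/

set_option linter.dupNamespace false
set_option autoImplicit false

noncomputable section

open scoped Classical Pointwise

open Literature Literature.NumberTheory.EllipticCurves WeierstrassCurve

namespace Summit.BirchSwinnertonDyer.BirchSwinnertonDyer.Theorems.HeegnerMuPartStabilized

/-- **A `SpecWitness` at `q_m` from S1 (control) and S2 (DVR structure) data.** See the module docstring.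
Conversions used: `q_m • H = 0` from the scalar tower; `Finite (AddCommGroup.torsion Xq)` and
`#(AddCommGroup.torsion Xq) = #(torsion_{S_m} Xq)` (`IwasawaAlgebra.mem_addTorsion_iff_mem_torsion`);
`#Xq_tors = p^{ℓ(Xq_tors)} ≤ p^{2ℓ(H/S_m∙κ₁)} = #(H ⧸ S_m∙κ₁)² = #(H ⧸ Λ∙κ₁)²`
(`IwasawaAlgebra.natCard_eq_pow_length_quotient_X_pow_add_C_of_finite`,
`IwasawaAlgebra.finite_quotient_span_singleton_of_linearEquiv`, `Submodule.restrictScalars_span`).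
[cite: Howard2004HeegnerKolyvagin, Thm. 1.6.1 and proof of Thm. 2.2.10 (𝔮 = T^m + p)] [cite: MastellaZerman2026, Thm. 2.40] -/
theorem nonempty_specWitness_of_dvrData {p : ℕ} [hp : Fact p.Prime] {m : ℕ} (hm : 1 ≤ m)
    {S X : Type} [AddCommGroup S] [Module (IwasawaAlgebra p) S] [AddCommGroup X] [Module (IwasawaAlgebra p) X]
    (L : Submodule (IwasawaAlgebra p) S)
    {H Xq : Type} [AddCommGroup H] [Module (IwasawaAlgebra p) H]
    [Module (IwasawaAlgebra p ⧸
      Ideal.span {(PowerSeries.X ^ m + PowerSeries.C (p : ℤ_[p]) : IwasawaAlgebra p)}) H]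
    [IsScalarTower (IwasawaAlgebra p) (IwasawaAlgebra p ⧸
      Ideal.span {(PowerSeries.X ^ m + PowerSeries.C (p : ℤ_[p]) : IwasawaAlgebra p)}) H]
    [AddCommGroup Xq] [Module (IwasawaAlgebra p) Xq]
    [Module (IwasawaAlgebra p ⧸
      Ideal.span {(PowerSeries.X ^ m + PowerSeries.C (p : ℤ_[p]) : IwasawaAlgebra p)}) Xq]
    [IsScalarTower (IwasawaAlgebra p) (IwasawaAlgebra p ⧸
      Ideal.span {(PowerSeries.X ^ m + PowerSeries.C (p : ℤ_[p]) : IwasawaAlgebra p)}) Xq]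
    [Module.Finite (IwasawaAlgebra p ⧸
      Ideal.span {(PowerSeries.X ^ m + PowerSeries.C (p : ℤ_[p]) : IwasawaAlgebra p)}) Xq]
    -- S1: control
    (f : S →ₗ[IwasawaAlgebra p] H) (κ₁ : H) (hL : L.map f ≤ (IwasawaAlgebra p) ∙ κ₁) (c : ℕ)
    (hcoker : Finite (H ⧸ LinearMap.range f)) (hcoker_le : Nat.card (H ⧸ LinearMap.range f) ≤ c)
    (h : (X ⧸ ((Ideal.span {(PowerSeries.X ^ m + PowerSeries.C (p : ℤ_[p]) : IwasawaAlgebra p)} :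
        Ideal (IwasawaAlgebra p)) • (⊤ : Submodule (IwasawaAlgebra p) X))) →ₗ[IwasawaAlgebra p] Xq)
    (hker : Finite (LinearMap.ker h)) (hker_le : Nat.card (LinearMap.ker h) ≤ c)
    -- S2: DVR structure
    (e : H ≃ₗ[IwasawaAlgebra p ⧸
      Ideal.span {(PowerSeries.X ^ m + PowerSeries.C (p : ℤ_[p]) : IwasawaAlgebra p)}]
      (IwasawaAlgebra p ⧸ Ideal.span {(PowerSeries.X ^ m + PowerSeries.C (p : ℤ_[p]) : IwasawaAlgebra p)}))
    (hκ : κ₁ ≠ 0)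
    (hS2 : Module.length (IwasawaAlgebra p ⧸
        Ideal.span {(PowerSeries.X ^ m + PowerSeries.C (p : ℤ_[p]) : IwasawaAlgebra p)})
        (Submodule.torsion (IwasawaAlgebra p ⧸
          Ideal.span {(PowerSeries.X ^ m + PowerSeries.C (p : ℤ_[p]) : IwasawaAlgebra p)}) Xq) ≤
      2 * Module.length (IwasawaAlgebra p ⧸
        Ideal.span {(PowerSeries.X ^ m + PowerSeries.C (p : ℤ_[p]) : IwasawaAlgebra p)})
        (H ⧸ Submodule.span (IwasawaAlgebra p ⧸
          Ideal.span {(PowerSeries.X ^ m + PowerSeries.C (p : ℤ_[p]) : IwasawaAlgebra p)}) {κ₁})) :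
    Nonempty (SpecWitness (IwasawaAlgebra p) S X L
      (PowerSeries.X ^ m + PowerSeries.C (p : ℤ_[p]) : IwasawaAlgebra p) c) := by
  -- (0) `q_m` kills `H`
  have hsmul : (Ideal.span {(PowerSeries.X ^ m + PowerSeries.C (p : ℤ_[p]) : IwasawaAlgebra p)} :
      Ideal (IwasawaAlgebra p)) • (⊤ : Submodule (IwasawaAlgebra p) H) = ⊥ := by
    rw [Submodule.ideal_span_singleton_smul, eq_bot_iff]
    intro y hy
    obtain ⟨x, -, rfl⟩ := (Submodule.mem_smul_pointwise_iff_exists y _ ⊤).1 hy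
    rw [Submodule.mem_bot, ← IsScalarTower.algebraMap_smul (IwasawaAlgebra p ⧸
      Ideal.span {(PowerSeries.X ^ m + PowerSeries.C (p : ℤ_[p]) : IwasawaAlgebra p)}),
      Ideal.Quotient.algebraMap_eq,
      Ideal.Quotient.eq_zero_iff_mem.mpr (Ideal.mem_span_singleton_self _)]
    exact zero_smul (IwasawaAlgebra p ⧸
      Ideal.span {(PowerSeries.X ^ m + PowerSeries.C (p : ℤ_[p]) : IwasawaAlgebra p)}) x
  -- (1) the `ℤ`-torsion of `Xq` is finite, of cardinality `#M ^ 2`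
  have hfinTors : Finite (AddCommGroup.torsion Xq) := IwasawaAlgebra.finite_addTorsion p hm
  have eT : (AddCommGroup.torsion Xq) ≃ (Submodule.torsion (IwasawaAlgebra p ⧸
      Ideal.span {(PowerSeries.X ^ m + PowerSeries.C (p : ℤ_[p]) : IwasawaAlgebra p)}) Xq) :=
    { toFun := fun x => ⟨x.1, (IwasawaAlgebra.mem_addTorsion_iff_mem_torsion p hm x.1).mp x.2⟩
      invFun := fun x => ⟨x.1, (IwasawaAlgebra.mem_addTorsion_iff_mem_torsion p hm x.1).mpr x.2⟩
      left_inv := fun _ => rfl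
      right_inv := fun _ => rfl }
  haveI hfinTorsS : Finite (Submodule.torsion (IwasawaAlgebra p ⧸
      Ideal.span {(PowerSeries.X ^ m + PowerSeries.C (p : ℤ_[p]) : IwasawaAlgebra p)}) Xq) :=
    IwasawaAlgebra.finite_torsion p hm
  have hcardTors : Nat.card (AddCommGroup.torsion Xq) = Nat.card (Submodule.torsion (IwasawaAlgebra p ⧸
      Ideal.span {(PowerSeries.X ^ m + PowerSeries.C (p : ℤ_[p]) : IwasawaAlgebra p)}) Xq) :=
    Nat.card_congr eT
  -- (2) `H ⧸ S_m∙κ₁` is finite and has the same cardinality as `H ⧸ Λ∙κ₁`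
  have hfinQuotS := IwasawaAlgebra.finite_quotient_span_singleton_of_linearEquiv p hm e κ₁ hκ
  have hspan : (Submodule.span (IwasawaAlgebra p ⧸
      Ideal.span {(PowerSeries.X ^ m + PowerSeries.C (p : ℤ_[p]) : IwasawaAlgebra p)}) {κ₁}).restrictScalars
        (IwasawaAlgebra p) = (IwasawaAlgebra p) ∙ κ₁ :=
    Submodule.restrictScalars_span (IwasawaAlgebra p) (IwasawaAlgebra p ⧸
      Ideal.span {(PowerSeries.X ^ m + PowerSeries.C (p : ℤ_[p]) : IwasawaAlgebra p)})
      Ideal.Quotient.mk_surjective {κ₁}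
  have eQ : (H ⧸ ((IwasawaAlgebra p) ∙ κ₁)) ≃ (H ⧸ Submodule.span (IwasawaAlgebra p ⧸
      Ideal.span {(PowerSeries.X ^ m + PowerSeries.C (p : ℤ_[p]) : IwasawaAlgebra p)}) {κ₁}) :=
    ((Submodule.quotEquivOfEq _ _ hspan.symm).trans
      (Submodule.Quotient.restrictScalarsEquiv (IwasawaAlgebra p) _)).toEquiv
  have hfinQuot : Finite (H ⧸ ((IwasawaAlgebra p) ∙ κ₁)) := Finite.of_equiv _ eQ.symm
  -- (3) the S2 inequality in cardinalities: `#Xq_tors = p^{ℓ(Xq_tors)} ≤ p^{2 ℓ(H/κ₁)} = #(H/κ₁)²`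
  haveI := hfinQuotS
  have hcardle : Nat.card (Submodule.torsion (IwasawaAlgebra p ⧸
      Ideal.span {(PowerSeries.X ^ m + PowerSeries.C (p : ℤ_[p]) : IwasawaAlgebra p)}) Xq) ≤
      Nat.card (H ⧸ ((IwasawaAlgebra p) ∙ κ₁)) ^ 2 := by
    rw [Nat.card_congr eQ]
    exact IwasawaAlgebra.natCard_le_pow_of_length_le_mul p hm
      (N := Submodule.torsion (IwasawaAlgebra p ⧸
        Ideal.span {(PowerSeries.X ^ m + PowerSeries.C (p : ℤ_[p]) : IwasawaAlgebra p)}) Xq)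
      (N' := H ⧸ Submodule.span (IwasawaAlgebra p ⧸
        Ideal.span {(PowerSeries.X ^ m + PowerSeries.C (p : ℤ_[p]) : IwasawaAlgebra p)}) {κ₁}) 2
      (by exact_mod_cast hS2)
  refine ⟨SpecWitness.mk (H := H) (Xq := Xq) (κ₁ := κ₁) (f := f) (h := h) (smul_top_eq_bot := hsmul)
    (map_le := hL) (finite_coker := hcoker) (card_coker_le := hcoker_le) (finite_ker := hker)
    (card_ker_le := hker_le) (finite_torsion := hfinTors) (finite_quot := hfinQuot)
    (card_torsion_le_sq := ?_)⟩
  rw [hcardTors]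
  exact hcardle

/-- **Corollary: the `M ⊕ M` shape.** Same, with S2 given as an `S_m`-isomorphism `Xq_tors ≅ M ⊕ M` for a finite
`M` with `ℓ(M) ≤ ℓ(H ⧸ S_m∙κ₁)` (Howard Thm. 1.6.1's literal shape `H¹_ℱ(K,A) ≅ D ⊕ M ⊕ M`).
[cite: Howard2004HeegnerKolyvagin, Thm. 1.6.1] [cite: MastellaZerman2026, Thm. 2.40] -/
theorem nonempty_specWitness_of_dvrData_prod {p : ℕ} [hp : Fact p.Prime] {m : ℕ} (hm : 1 ≤ m)
    {S X : Type} [AddCommGroup S] [Module (IwasawaAlgebra p) S] [AddCommGroup X] [Module (IwasawaAlgebra p) X]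
    (L : Submodule (IwasawaAlgebra p) S)
    {H Xq : Type} [AddCommGroup H] [Module (IwasawaAlgebra p) H]
    [Module (IwasawaAlgebra p ⧸
      Ideal.span {(PowerSeries.X ^ m + PowerSeries.C (p : ℤ_[p]) : IwasawaAlgebra p)}) H]
    [IsScalarTower (IwasawaAlgebra p) (IwasawaAlgebra p ⧸
      Ideal.span {(PowerSeries.X ^ m + PowerSeries.C (p : ℤ_[p]) : IwasawaAlgebra p)}) H]
    [AddCommGroup Xq] [Module (IwasawaAlgebra p) Xq]
    [Module (IwasawaAlgebra p ⧸
      Ideal.span {(PowerSeries.X ^ m + PowerSeries.C (p : ℤ_[p]) : IwasawaAlgebra p)}) Xq]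
    [IsScalarTower (IwasawaAlgebra p) (IwasawaAlgebra p ⧸
      Ideal.span {(PowerSeries.X ^ m + PowerSeries.C (p : ℤ_[p]) : IwasawaAlgebra p)}) Xq]
    [Module.Finite (IwasawaAlgebra p ⧸
      Ideal.span {(PowerSeries.X ^ m + PowerSeries.C (p : ℤ_[p]) : IwasawaAlgebra p)}) Xq]
    (f : S →ₗ[IwasawaAlgebra p] H) (κ₁ : H) (hL : L.map f ≤ (IwasawaAlgebra p) ∙ κ₁) (c : ℕ)
    (hcoker : Finite (H ⧸ LinearMap.range f)) (hcoker_le : Nat.card (H ⧸ LinearMap.range f) ≤ c)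
    (h : (X ⧸ ((Ideal.span {(PowerSeries.X ^ m + PowerSeries.C (p : ℤ_[p]) : IwasawaAlgebra p)} :
        Ideal (IwasawaAlgebra p)) • (⊤ : Submodule (IwasawaAlgebra p) X))) →ₗ[IwasawaAlgebra p] Xq)
    (hker : Finite (LinearMap.ker h)) (hker_le : Nat.card (LinearMap.ker h) ≤ c)
    (e : H ≃ₗ[IwasawaAlgebra p ⧸
      Ideal.span {(PowerSeries.X ^ m + PowerSeries.C (p : ℤ_[p]) : IwasawaAlgebra p)}]
      (IwasawaAlgebra p ⧸ Ideal.span {(PowerSeries.X ^ m + PowerSeries.C (p : ℤ_[p]) : IwasawaAlgebra p)}))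
    (hκ : κ₁ ≠ 0)
    {M : Type} [AddCommGroup M]
    [Module (IwasawaAlgebra p ⧸
      Ideal.span {(PowerSeries.X ^ m + PowerSeries.C (p : ℤ_[p]) : IwasawaAlgebra p)}) M] [Finite M]
    (eM : Submodule.torsion (IwasawaAlgebra p ⧸
        Ideal.span {(PowerSeries.X ^ m + PowerSeries.C (p : ℤ_[p]) : IwasawaAlgebra p)}) Xq ≃ₗ[
      IwasawaAlgebra p ⧸ Ideal.span {(PowerSeries.X ^ m + PowerSeries.C (p : ℤ_[p]) : IwasawaAlgebra p)}]
      (M × M))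
    (hM : Module.length (IwasawaAlgebra p ⧸
        Ideal.span {(PowerSeries.X ^ m + PowerSeries.C (p : ℤ_[p]) : IwasawaAlgebra p)}) M ≤
      Module.length (IwasawaAlgebra p ⧸
        Ideal.span {(PowerSeries.X ^ m + PowerSeries.C (p : ℤ_[p]) : IwasawaAlgebra p)})
        (H ⧸ Submodule.span (IwasawaAlgebra p ⧸
          Ideal.span {(PowerSeries.X ^ m + PowerSeries.C (p : ℤ_[p]) : IwasawaAlgebra p)}) {κ₁})) :
    Nonempty (SpecWitness (IwasawaAlgebra p) S X L
      (PowerSeries.X ^ m + PowerSeries.C (p : ℤ_[p]) : IwasawaAlgebra p) c) := by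
  refine nonempty_specWitness_of_dvrData hm L f κ₁ hL c hcoker hcoker_le h hker hker_le e hκ ?_
  rw [eM.length_eq, Module.length_prod, ← two_mul]
  gcongr

end Summit.BirchSwinnertonDyer.BirchSwinnertonDyer.Theorems.HeegnerMuPartStabilized

end
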